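import Summits.HubbardSuperconductivity.HubbardSuperconductivity.Theorems.WeakCouplingBCSDefsKlCertTPrime

/-!
# The «vertex propagation leaf»: `B1g` dominance on a whole `t′`-SEGMENT from two certified VERTEX cells (KL-MARGIN-SCAN HQ1 (iii), dual reading)

Reader seat hubbard-klscan-idea-3 (lens: dual certificates / obstruction reading of the margin table), round 7; bears on the certificate
half of `Theses.WeakCouplingBCS.WcbcsKohnLuttingerB1g` (stmt-HubbardSuperconductivity-0158) and on the director's HQ1 (iii) «single sign
crossing along `t′` at `δ = ⅛`».  HONEST FRAMING: a Kohn–Luttinger `O(U²)` channel statement is not ODLRO and nothing here proves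
superconductivity in the Hubbard model; NO margin at any `t′ ≠ 0` is asserted; nothing is said about `K₃`, `U₀` or the onset window; the file
contains NO numerical record.  It fixes the SHAPE of a segment certificate and PROVES its soundness from order theory alone.

THE DUAL READING.  Every certified word of the scan so far is a CELL: one `t′`, one `μ`-box.  A continuum statement in `t′` («no crossing on
`[t₁, t₂]`») cannot be reached by cells plus first-order transport: the kernel moves by `≈ 0.2–0.4` in operator norm per `0.02` of `t′` on the
`δ = ⅛` line (floats), so a cell's margin (`0.24–0.6`) is spent after `|Δt′| ≈ 0.015`.  The dual structure of the margin does better.  After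
pulling every cell of the segment back to ONE reference state space (a chart of the Fermi curves; the isometric identification
`ψ ↦ ψ·√w_{t′}` of `L²(σ_{t′})` with `L²(dθ)` makes the admissible state set COMMON to all `t′`) and dividing by a positive gauge `g(t′)`
(the total density of states `W(t′) = σ_{t′}(fermi curve)` is the one that works in floats), each channel bottom is an INFIMUM OF LINEAR
functionals of the pulled-back form `q_{t′}` — hence CONCAVE in `q` (Horn–Johnson 4.3.P14 for matrices): if `q_{t′} ≥ (1−θ)q_{t₁} + θq_{t₂} − R`
on the rival sector (a one-sided SAG budget `R` of the chart family below its chord), the rival floor INTERPOLATES from the two vertices up to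
`R`; and ONE fixed `d`-wave test state `ψ₀` carries the `B1g` ceiling along the chord up to a bulge budget `R′`.  So two certified vertex cells
plus two crude curvature budgets certify the whole segment (`klB1gDominatesOnLine_of_chart`), and a FAILED interior margin between two
certified vertices would itself certify a chart curvature `≥` the interpolated vertex margin — the obstruction reading.  Floats (`δ = ⅛`,
`M = 128/192` Galerkin, DOS gauge): sag budgets `≤ 0.008·W⁻¹` against interpolated margins `≈ 0.03·W⁻¹` at vertex spacing `0.08`
(`87–92 %` of the true margin retained), spacing `0.12` still positive (`32–55 %`); raw gauge fails at `0.12` (the DOS weight `W(t′)` is convex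
towards the van Hove level and its sag sits in the `A1g` block).  The budgets `R, R′` are the ONE continuum input and tolerate `O(1)` relative
error; they are an ENGINE item (interval second `t′`-derivatives of the chart-family entries), not delivered here.

* §1 abstract vertex propagation: `sInf` of an image is super-affine along chords up to the sag budget (`chord_le_sInf_image`), a test state
  carries a ceiling (`sInf_image_le_of_testState`), and the margin composition (`margin_of_chord`).
* §2 the continuum conclusion `KLB1gDominatesOnLineTP δ t₁ t₂ γ` (dominance at every point of the iso-density segment), its reading as a family
  of degenerate-window cell conclusions (`klB1gDominatesAtTP_point_of_onLine`) and the strict no-crossing consequence (`noCrossingOn_of_onLine`).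
* §3 the charted-segment datum `KLChartedLine` (reference state sets, pulled-back gauge-normalised forms, the gauge, and the EXACTNESS field
  equating `channelInf` with `g · sInf`) and the soundness theorem `klB1gDominatesOnLine_of_chart`: vertex floors/ceilings + sag/bulge budgets
  ⇒ `KLB1gDominatesOnLineTP`.
* §4 the two named TARGET SEGMENTS of the `δ = ⅛` line outside the van Hove zone (statements only, nothing claimed): `SegmentRow_d0125_G`
  (`t′ ∈ [−3/25, 0]`), `SegmentRow_d0125_M` (`t′ ∈ [−3/10, −9/50]`), and their joint reading `hq1iii_offVH_of_segments`: any `B1g → χ`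
  crossing on `[−3/10, 0]` at `δ = ⅛` lies in the van Hove zone `(−9/50, −3/25)`.

References: R. A. Horn, C. R. Johnson, *Matrix Analysis* (2nd ed., CUP 2012), 4.3.P14 (concavity of the smallest eigenvalue) and Thm 4.3.1
(Weyl); A. Weinstein, W. Stenger, *Methods of Intermediate Problems for Eigenvalues* (Academic Press 1972), ch. 2 (lower bounds from a
comparison form); S. Raghu, S. A. Kivelson, D. J. Scalapino, Phys. Rev. B 81 (2010) 224505, §III; R. Hlubina, Phys. Rev. B 59 (1999) 9600
(the float `t`–`t′` weak-coupling phase diagram).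
-/

noncomputable section

-- the tree's namespace convention repeats the summit name by design (D-0017)
set_option linter.dupNamespace false

open Set
open Literature.MathematicalPhysics.QuantumLattice
open Summit.HubbardSuperconductivity.HubbardSuperconductivity.Theorems

namespace Summit.HubbardSuperconductivity.HubbardSuperconductivity.Theorems.KlVertexPropagation

/-! ## §1  Abstract vertex propagation: infima of families of linear data are super-affine along chords -/

/-- **Chord floor.**  If on a state set `S` the functional `q` dominates the chord of `q₁, q₂` up to a sag budget `R`,
`(1−θ)·q₁ ψ + θ·q₂ ψ − R ≤ q ψ` (`0 ≤ θ ≤ 1`), then `inf q` dominates the chord of the two infima up to `R` — concavity of an infimum of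
linear data (for symmetric matrices: the smallest eigenvalue is concave, Horn–Johnson 4.3.P14). [folklore] -/
theorem chord_le_sInf_image {ι : Type*} {S : Set ι} {q₁ q₂ q : ι → ℝ} {θ R : ℝ} (hS : S.Nonempty)
    (h₁ : BddBelow (q₁ '' S)) (h₂ : BddBelow (q₂ '' S)) (hθ₀ : 0 ≤ θ) (hθ₁ : θ ≤ 1)
    (h : ∀ ψ ∈ S, (1 - θ) * q₁ ψ + θ * q₂ ψ - R ≤ q ψ) :
    (1 - θ) * sInf (q₁ '' S) + θ * sInf (q₂ '' S) - R ≤ sInf (q '' S) := by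
  refine le_csInf (hS.image q) ?_
  rintro _ ⟨ψ, hψ, rfl⟩
  have ha : sInf (q₁ '' S) ≤ q₁ ψ := csInf_le h₁ ⟨ψ, hψ, rfl⟩
  have hb : sInf (q₂ '' S) ≤ q₂ ψ := csInf_le h₂ ⟨ψ, hψ, rfl⟩
  have ha' : (1 - θ) * sInf (q₁ '' S) ≤ (1 - θ) * q₁ ψ := mul_le_mul_of_nonneg_left ha (by linarith)
  have hb' : θ * sInf (q₂ '' S) ≤ θ * q₂ ψ := mul_le_mul_of_nonneg_left hb hθ₀
  linarith [h ψ hψ]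

/-- **Test-state ceiling.**  One admissible state `ψ₀` whose value follows the chord of its two vertex values up to a bulge budget `R′`
bounds `inf q` from above (Rayleigh–Ritz with a FIXED trial state transported along the chart). [folklore] -/
theorem sInf_image_le_of_testState {ι : Type*} {S : Set ι} {q : ι → ℝ} {ψ₀ : ι} {c : ℝ} (hq : BddBelow (q '' S))
    (hψ₀ : ψ₀ ∈ S) (h : q ψ₀ ≤ c) : sInf (q '' S) ≤ c :=
  (csInf_le hq ⟨ψ₀, hψ₀, rfl⟩).trans h

/-- **Margin composition.**  A rival floor following the chord of the vertex floors up to `R` and a `B1g` ceiling following the chord of the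
vertex ceilings up to `R′` give an interior margin `≥ min` of the two vertex margins `− (R + R′)`. [folklore] -/
theorem margin_of_chord {F F₁ F₂ C C₁ C₂ θ R R' m : ℝ} (hθ₀ : 0 ≤ θ) (hθ₁ : θ ≤ 1)
    (hF : (1 - θ) * F₁ + θ * F₂ - R ≤ F) (hC : C ≤ (1 - θ) * C₁ + θ * C₂ + R')
    (h₁ : C₁ + m ≤ F₁) (h₂ : C₂ + m ≤ F₂) : C + (m - (R + R')) ≤ F := by
  nlinarith

/-! ## §2  The continuum conclusion on an iso-density segment and what it decides -/

/-- **`B1g` dominance along an iso-density `t′`-segment** (the shape a SEGMENT certificate concludes; the continuum object of HQ1 (iii)): for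
every `t′ ∈ [t₁, t₂]`, at the free-band chemical potential `μ(δ; t′)` of hole doping `δ` and `U = 1`, the `B1g` bottom lies by `γ` below every
other channel bottom.  Compare the CELL conclusion `KLB1gDominatesAtTP` (one `t′`, a `μ`-box). [cite: RaghuKivelsonScalapino2010, §II (7), (13)] -/
def KLB1gDominatesOnLineTP (δ t₁ t₂ γ : ℝ) : Prop :=
  ∀ tp ∈ Icc t₁ t₂, ∀ χ : D4Irrep, χ ≠ D4Irrep.B1g →
    channelInf (squareDispersion 1 tp) (klMuOfDopingTP tp δ) 1 D4Irrep.B1g + γ ≤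
      channelInf (squareDispersion 1 tp) (klMuOfDopingTP tp δ) 1 χ

/-- A segment conclusion contains the degenerate-window cell conclusion at each of its points (the converse — cells to segment — is what §3 is for).
[folklore] -/
theorem klB1gDominatesAtTP_point_of_onLine {δ t₁ t₂ γ tp : ℝ} (h : KLB1gDominatesOnLineTP δ t₁ t₂ γ) (htp : tp ∈ Icc t₁ t₂) :
    KLB1gDominatesAtTP tp (klMuOfDopingTP tp δ) (klMuOfDopingTP tp δ) γ := by
  intro μ hμ χ hχ
  obtain rfl : μ = klMuOfDopingTP tp δ := le_antisymm hμ.2 hμ.1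
  exact h tp htp χ hχ

/-- **No crossing on the segment.**  A segment conclusion with `γ > 0` excludes any change of the leading channel on `[t₁, t₂]`: `B1g` is
STRICTLY the lowest channel at every point (the positive half of HQ1 (iii) on that segment). [folklore] -/
theorem noCrossingOn_of_onLine {δ t₁ t₂ γ : ℝ} (hγ : 0 < γ) (h : KLB1gDominatesOnLineTP δ t₁ t₂ γ) :
    ∀ tp ∈ Icc t₁ t₂, ∀ χ : D4Irrep, χ ≠ D4Irrep.B1g →
      channelInf (squareDispersion 1 tp) (klMuOfDopingTP tp δ) 1 D4Irrep.B1g <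
        channelInf (squareDispersion 1 tp) (klMuOfDopingTP tp δ) 1 χ := by
  intro tp htp χ hχ
  have := h tp htp χ hχ
  linarith

/-! ## §3  The charted segment and the soundness of vertex propagation -/

/-- **A charted iso-density segment** — the datum an engine must supply before any propagation: a reference index type `ι` of states, per
channel the admissible reference set `S χ`, for each `t′` the pulled-back GAUGE-NORMALISED channel forms `q t′ χ : ι → ℝ`, a positive gauge
`g` (intended: the total density of states `W(t′)` of the Fermi curve at `μ(δ; t′)`), and the EXACTNESS field: on the segment,
`channelInf ε_{t′} μ(δ;t′) 1 χ = g(t′) · inf (q t′ χ) (S χ)` (intended realisation: the isometry `ψ ↦ ψ·√w_{t′}` of `L²(σ_{t′})` onto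
`L²(dθ)` of a polar or Blaschke chart, which makes the unit spheres of all `t′` one set).  A hypothesis-carrying structure: NOTHING is claimed to
exist here. [folklore] -/
structure KLChartedLine (δ t₁ t₂ : ℝ) where
  /-- reference index type of states -/
  ι : Type
  /-- admissible reference states of channel `χ` -/
  S : D4Irrep → Set ι
  /-- pulled-back, gauge-normalised channel form at `t′` -/
  q : ℝ → D4Irrep → ι → ℝ
  /-- the gauge -/
  g : ℝ → ℝ
  S_nonempty : ∀ χ, (S χ).Nonempty
  q_bddBelow : ∀ tp χ, BddBelow (q tp χ '' S χ)
  g_pos : ∀ tp ∈ Icc t₁ t₂, 0 < g tp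
  exact : ∀ tp ∈ Icc t₁ t₂, ∀ χ : D4Irrep,
    channelInf (squareDispersion 1 tp) (klMuOfDopingTP tp δ) 1 χ = g tp * sInf (q tp χ '' S χ)

/-- **Soundness of vertex propagation.**  On a charted segment `[t₁, t₂]` (`t₁ < t₂`) suppose: (V) VERTEX DATA — rival floors
`F₁ χ ≤ inf q_{t₁} χ`, `F₂ χ ≤ inf q_{t₂} χ` (`χ ≠ B1g`) and one `B1g` test state `ψ₀` with `q_{t₁} B1g ψ₀ ≤ C₁`, `q_{t₂} B1g ψ₀ ≤ C₂` (what two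
certified vertex CELLS deliver); (S) SAG BUDGET — for every `t′` of the segment, with `θ = (t′ − t₁)/(t₂ − t₁)`, every rival form dominates its
chord up to `R`; (B) BULGE BUDGET — the test value `q_{t′} B1g ψ₀` exceeds its chord by at most `R′`; (M) both vertex margins are
`≥ γ + R + R′` with `γ ≥ 0`; (G) `G ≤ g` on the segment.  THEN `KLB1gDominatesOnLineTP δ t₁ t₂ (G·γ)`.  The budgets (S), (B) are the only
continuum input (interval second `t′`-derivatives of the chart family; an ENGINE item). [folklore] -/
theorem klB1gDominatesOnLine_of_chart {δ t₁ t₂ : ℝ} (L : KLChartedLine δ t₁ t₂) (ht : t₁ < t₂)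
    {F₁ F₂ : D4Irrep → ℝ} {ψ₀ : L.ι} {C₁ C₂ R R' γ G : ℝ}
    (hF₁ : ∀ χ, χ ≠ D4Irrep.B1g → F₁ χ ≤ sInf (L.q t₁ χ '' L.S χ))
    (hF₂ : ∀ χ, χ ≠ D4Irrep.B1g → F₂ χ ≤ sInf (L.q t₂ χ '' L.S χ))
    (hψ₀ : ψ₀ ∈ L.S D4Irrep.B1g) (hC₁ : L.q t₁ D4Irrep.B1g ψ₀ ≤ C₁) (hC₂ : L.q t₂ D4Irrep.B1g ψ₀ ≤ C₂)
    (hSag : ∀ tp ∈ Icc t₁ t₂, ∀ χ, χ ≠ D4Irrep.B1g → ∀ ψ ∈ L.S χ,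
      (1 - (tp - t₁) / (t₂ - t₁)) * L.q t₁ χ ψ + (tp - t₁) / (t₂ - t₁) * L.q t₂ χ ψ - R ≤ L.q tp χ ψ)
    (hBulge : ∀ tp ∈ Icc t₁ t₂,
      L.q tp D4Irrep.B1g ψ₀ ≤ (1 - (tp - t₁) / (t₂ - t₁)) * L.q t₁ D4Irrep.B1g ψ₀ + (tp - t₁) / (t₂ - t₁) * L.q t₂ D4Irrep.B1g ψ₀ + R')
    (hm₁ : ∀ χ, χ ≠ D4Irrep.B1g → C₁ + (γ + R + R') ≤ F₁ χ) (hm₂ : ∀ χ, χ ≠ D4Irrep.B1g → C₂ + (γ + R + R') ≤ F₂ χ)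
    (hγ : 0 ≤ γ) (hG : ∀ tp ∈ Icc t₁ t₂, G ≤ L.g tp) :
    KLB1gDominatesOnLineTP δ t₁ t₂ (G * γ) := by
  intro tp htp χ hχ
  have h21 : 0 < t₂ - t₁ := sub_pos.mpr ht
  set θ : ℝ := (tp - t₁) / (t₂ - t₁) with hθ
  have hθ₀ : 0 ≤ θ := div_nonneg (by linarith [htp.1]) h21.le
  have hθ₁ : θ ≤ 1 := by rw [hθ, div_le_one h21]; linarith [htp.2]
  -- rival floor along the chord
  have hfloor : (1 - θ) * F₁ χ + θ * F₂ χ - R ≤ sInf (L.q tp χ '' L.S χ) := by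
    have hc := chord_le_sInf_image (L.S_nonempty χ) (L.q_bddBelow t₁ χ) (L.q_bddBelow t₂ χ) hθ₀ hθ₁ (hSag tp htp χ hχ)
    have ha : (1 - θ) * F₁ χ ≤ (1 - θ) * sInf (L.q t₁ χ '' L.S χ) := mul_le_mul_of_nonneg_left (hF₁ χ hχ) (by linarith)
    have hb : θ * F₂ χ ≤ θ * sInf (L.q t₂ χ '' L.S χ) := mul_le_mul_of_nonneg_left (hF₂ χ hχ) hθ₀
    linarith
  -- `B1g` ceiling along the chord
  have hceil : sInf (L.q tp D4Irrep.B1g '' L.S D4Irrep.B1g) ≤ (1 - θ) * C₁ + θ * C₂ + R' := by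
    refine sInf_image_le_of_testState (L.q_bddBelow tp D4Irrep.B1g) hψ₀ ((hBulge tp htp).trans ?_)
    have ha : (1 - θ) * L.q t₁ D4Irrep.B1g ψ₀ ≤ (1 - θ) * C₁ := mul_le_mul_of_nonneg_left hC₁ (by linarith)
    have hb : θ * L.q t₂ D4Irrep.B1g ψ₀ ≤ θ * C₂ := mul_le_mul_of_nonneg_left hC₂ hθ₀
    linarith
  -- normalised margin, then undo the gauge
  have hmarg : sInf (L.q tp D4Irrep.B1g '' L.S D4Irrep.B1g) + γ ≤ sInf (L.q tp χ '' L.S χ) := by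
    have := margin_of_chord hθ₀ hθ₁ hfloor hceil (hm₁ χ hχ) (hm₂ χ hχ)
    linarith
  have hg : 0 < L.g tp := L.g_pos tp htp
  rw [L.exact tp htp D4Irrep.B1g, L.exact tp htp χ]
  have h1 : L.g tp * sInf (L.q tp D4Irrep.B1g '' L.S D4Irrep.B1g) + L.g tp * γ ≤ L.g tp * sInf (L.q tp χ '' L.S χ) := by
    have := mul_le_mul_of_nonneg_left hmarg hg.le
    linarith [mul_add (L.g tp) (sInf (L.q tp D4Irrep.B1g '' L.S D4Irrep.B1g)) γ]
  have h2 : G * γ ≤ L.g tp * γ := mul_le_mul_of_nonneg_right (hG tp htp) hγ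
  linarith

/-! ## §4  The two target segments of the `δ = ⅛` line outside the van Hove zone (statements only) -/

/-- TARGET SEGMENT (`Γ` side): `B1g` dominance by `1/100` at every `t′ ∈ [−3/25, 0]` on the `δ = ⅛` iso-density line.  Float picture
(`M = 128`, DOS gauge): vertices `t′ = 0, −3/25` with true margins `0.24, 0.55`; worst interior vertex-propagated margin `≈ 0.17` (`55 %`
retained).  NOT asserted (the card's own OPEN target — no fact tag; float picture cf. RaghuKivelsonScalapino2010 §III Fig. 3). -/
def SegmentRow_d0125_G : Prop := KLB1gDominatesOnLineTP (1 / 8) (-3 / 25) 0 (1 / 100)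

/-- TARGET SEGMENT (`M` side): `B1g` dominance by `1/100` at every `t′ ∈ [−3/10, −9/50]` on the `δ = ⅛` line.  Float picture: vertices
`t′ = −9/50, −3/10` (the latter is the funded cell j320108) with true margins `0.57, 0.24`; worst interior vertex-propagated margin `≈ 0.11`
(`32 %` retained); at spacing `0.08` (`[−3/10, −11/50]`) `92 %`.  NOT asserted (the card's own OPEN target — no fact tag; float picture cf. RaghuKivelsonScalapino2010 §III Fig. 3). -/
def SegmentRow_d0125_M : Prop := KLB1gDominatesOnLineTP (1 / 8) (-3 / 10) (-9 / 50) (1 / 100)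

/-- **What the two segments decide for HQ1 (iii)**: on the `δ = ⅛` line, any point of `[−3/10, 0]` where some channel `χ ≠ B1g` is NOT strictly
above `B1g` lies in the van Hove zone `(−9/50, −3/25)` (which contains the pole `t′ ≈ −0.150` where the Fermi curve meets the saddles and the
smooth-curve frame does not apply; that zone is the business of the selection-rule / endpoint cards, not of this leaf). [folklore] -/
theorem hq1iii_offVH_of_segments (hG : SegmentRow_d0125_G) (hM : SegmentRow_d0125_M) {tp : ℝ} (htp : tp ∈ Icc (-3 / 10 : ℝ) 0)
    {χ : D4Irrep} (hχ : χ ≠ D4Irrep.B1g)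
    (hle : channelInf (squareDispersion 1 tp) (klMuOfDopingTP tp (1 / 8)) 1 χ ≤
      channelInf (squareDispersion 1 tp) (klMuOfDopingTP tp (1 / 8)) 1 D4Irrep.B1g) :
    tp ∈ Ioo (-9 / 50 : ℝ) (-3 / 25) := by
  by_contra hz
  rw [mem_Ioo, not_and_or, not_lt, not_lt] at hz
  rcases hz with h | h
  · have := noCrossingOn_of_onLine (by norm_num) hM tp ⟨htp.1, h⟩ χ hχ
    linarith
  · have := noCrossingOn_of_onLine (by norm_num) hG tp ⟨h, htp.2⟩ χ hχ
    linarith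

end Summit.HubbardSuperconductivity.HubbardSuperconductivity.Theorems.KlVertexPropagation

end
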